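import Literature.NumberTheory.LFunctions.ZeroPairSecondMoment
import Mathlib.NumberTheory.ZetaValues
import Mathlib.NumberTheory.Harmonic.Bounds
import HarnessLib

/-!
# GLSS 2026, Theorem 2 from the second moment of pairs of zeros (display (3.2)) — proved

LABEL (cell `rh-crit`, corpus C5 `ah`): **NOT RH-BEARING.** RH-FREE corpus literature: the printed
deduction (§4) of Goldston–Lee–Schettler–Suriajaya 2026, Theorem 2 ("Assuming AH-Pairs, …") from
the unconditional second-moment statement (3.2) (`glss2026_dsec2`, `ZeroPairSecondMoment.lean`,
rh-crit/ah GAP row G-ah-10), with AH-Pairs a PREDICATE consumed as a hypothesis. THEOREMS ONLY (no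
definition of mathematical content beyond proof-local abbreviations, no named fact). bears_on:
LADDER-RH §4 HELD «conditional bridges: exceptional zero ⇒ …». WHAT THIS IS NOT: a claim about RH,
pair correlation or AH; nothing here bears on the truth of RH.

Source: [GoldstonLeeSchettlerSuriajaya2026] (held `paper:arxiv-2507.06823`), §1 (1.10)–(1.12)
(bins, densities, the pair-count bound), §2 (2.1) (the switch to the window `γ, γ' > T/log²T`), §3
(3.1)–(3.2), §4 (4.1)–(4.2) (proof of Theorem 2). Sibling of
`AlternativeHypothesisConsequences.lean` (statements and the deductions Thm 3 ⇐ Thm 2, Thm 4 /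
Cor 2 ⇐ Thm 3, Thm 1, Cor 1), which after this file rest on the single named fact `glss2026_dsec2`.

## The printed proof (§4) and its rendering

With `L = (1/2π) log T`, `x_p = (γ − γ')L` (`= AH.pairSpacing T p`), `M ≥ 4` even and AH-Pairs
data `(R, C)` at level `M`:
* (A) `L·𝒮(T, M) = Σ_{0<γ,γ'≤T, |x_p|≤M} (M − |x_p|)` (`GLSS2026.L_mul_secondMomentSum`) and the
  SWITCH (2.1): dropping the pairs with a member `≤ T/log²T` costs `O_M(T)` — such pairs have
  `|γ − γ'| ≤ M/L ≤ 1` and are `≤ N(T/log²T + 1)·3C₀ log(T + 4) = O(T)` in number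
  (`GLSS2026.exists_card_offWindow_le`, from the tree's unit-window bound and `N(u) ≪ u log u`;
  `GLSS2026.exists_switch_le`);
* (B) every pair of `𝒫(T, M)` lies in the bin `B_{k/2}` of its index `k = ⌈2x_p − ½⌉`, `|k| ≤ 2M`
  (`GLSS2026.binIndex`, `pairs_eq_bin_zero_union`, `sum_pairs_eq` — "`B_{k/2}(T)` … partitions
  `𝒫(T, M)` over `|k| ≤ 2M`"), and by AH-Pairs, for large `T`, within `r(T) = |C|(4M + 2)R(T) < 1/8`
  of the centre `k/2` (`eventually_abs_sub_binIndex_le`: the approximating half-integer `k'/2` of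
  (AH0) has `|k'| ≤ 4M + 1` and is the bin's), so no pair sits on a bin edge and the swap
  `(γ, γ') ↦ (γ', γ)` gives `|B_{−k/2}| = |B_{k/2}|` exactly (`card_bin_neg_eq`); hence (4.1):
  `Σ_{𝒫(T,M)} (M − |x_p|) = TL·(M P_0 + 2Σ_{j≤M}(M − j)(P_{j−½} + P_j) + Σ_{j≤M} P_{j−½}) + O(r(T)|𝒫(T,M)|)`;
* (C) the arithmetic after (4.2): `(3/2)M + 2Σ_{j≤M}(M − j)(1 − 2/(π²(2j−1)²)) = M² + log M/π² + θ`,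
  `|θ| ≤ 2` (`abs_mainTerms_sub_le`; `Σ_{j≥1}(2j−1)⁻² = π²/8` from Mathlib's `hasSum_zeta_two`, tail
  `≤ 1/M` by telescoping; the odd harmonic sum `= ½ log M + O(1)` from `harmonic_le_one_add_log`,
  `log_add_one_le_harmonic`);
* (D) `|𝒫(T, M)| ≤ #{|x_p| ≤ M} = O_M(TL)` from (3.2) ITSELF at `λ = 2M` (each such pair contributes
  `≥ M/L` to `𝒮(T, 2M) = O_M(T)`; `exists_eventually_card_closePairs_le`) — GLSS use the cruder
  (1.12) `Σ_{|k|≤2M} P_{k/2} ≪ M` from [GM87]; no second named fact is needed — and (3.2) at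
  `λ = M` (display (4.2)); assembly `glss2026_theorem2_of_dsec2`.

TYPING NOTE (rh-crit/ah R-g5-33, for the referee): in the typed `glss2026_theorem2` the threshold
in `T` follows `M, R, C` — exactly as in the printed proof (AH-Pairs "for sufficiently large `T`"
at level `M`; the switch "since `h ≤ M`, where `M` is fixed as `T → ∞`") — so every error that is
`o(1)` as `T → ∞` for fixed `M` ((3.2)'s `O(M²/L)`, the switch's `O(M/L)`, the `O(M²R(T))` of (4.1))
is absorbed by the absolute term `A√log M` (`M ≥ 4`, `√log M ≥ 1`): we take `A = 2|A₀| + 4`,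
`M₀ = 4`, `A' = 0`. The printed `O(M²(R(T) + 1/L²))` records the rate one would get under uniform
thresholds, which neither the print nor the typing tracks.

## Part E — the pair-count bound (1.12) from (3.2) (appended 2026-08-26)

`GLSS2026.exists_eventually_pairCount_window_le : glss2026_dsec2 → ∃ C ≥ 0, ∀ h > 0, ∀ᶠ T,
pairCorrelationCount (−h) h T ≤ C(1+h)·TL` — GLSS's (1.12) ([GM87]) stated over the tree's
`pairCorrelationCount`, with `pairCorrelationCount_neg_eq_card_closePairs`.

## References

* [GoldstonLeeSchettlerSuriajaya2026] §1 (1.10)–(1.12), §2 (2.1), §3 (3.1)–(3.2), §4 (4.1)–(4.2),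
  Theorem 2.
* [BaluyotGoldstonSuriajayaTurnageButterbaugh2025] §1 (`𝒫(T, M)`, `B_{k/2}`, `P_{k/2}`; AH-Pairs).
* [Titchmarsh1986] Thm. 9.2 (unit-window count), Thm. 9.4 (`N(T) ∼ TL`) — the tree inputs of (A).
-/

noncomputable section

open Filter Real
open scoped Topology

namespace Literature.NumberTheory.LFunctions

namespace GLSS2026

/-! ### A1. Off-window pairs are `O(T)` (GLSS (switch), the counting behind it) -/

/-- **Pairs with a member below `T/log²T` are `O(T)`**: there are `C, T₀` such that for `T ≥ T₀`
every set of pairs of zeros `0 < γ, γ' ≤ T` with `|γ − γ'| ≤ 1` and `min(γ, γ') ≤ T/log²T` has at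
most `C·T` elements (`≤ N(T/log²T + 1) · 3C₀ log(T + 4)`, unit-window bound and `N(u) ≪ u log u`).
This is the count behind GLSS's (switch), with `T/L`-many zeros below the cut.
[cite: GoldstonLeeSchettlerSuriajaya2026, §2 eq. (2.1) (switch)] -/
theorem exists_card_offWindow_le :
    ∃ C T₀ : ℝ, 0 ≤ C ∧ ∀ T : ℝ, T₀ ≤ T → ∀ A : Finset (ℕ × ℕ),
      A ⊆ zeroIndexSet T ×ˢ zeroIndexSet T →
      (∀ p ∈ A, |zetaOrdinate p.1 - zetaOrdinate p.2| ≤ 1) →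
      (∀ p ∈ A, zetaOrdinate p.1 ≤ T / Real.log T ^ 2 ∨ zetaOrdinate p.2 ≤ T / Real.log T ^ 2) →
      (A.card : ℝ) ≤ C * T := by
  classical
  obtain ⟨C₀, hC₀, hW⟩ := Montgomery.exists_zetaZeroCount_window_le
  obtain ⟨CN, hCN, hN⟩ := AH.exists_zetaZeroCount_le_mul_log
  have ev : ∀ᶠ T : ℝ in atTop, 8 ≤ T ∧ Real.log T ^ 2 / (1 * T + 0) ≤ 1 / 2 :=
    (eventually_ge_atTop 8).and
      ((Real.tendsto_pow_log_div_mul_add_atTop 1 0 2 one_ne_zero).eventually_le_const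
        (by norm_num))
  obtain ⟨T₀, hT₀⟩ := Filter.eventually_atTop.mp ev
  refine ⟨12 * CN * C₀, T₀, by positivity, fun T hT A hA hcl hoff ↦ ?_⟩
  obtain ⟨hT8, h3⟩ := hT₀ T hT
  have hTpos : 0 < T := by linarith
  have hlogT : 2 ≤ Real.log T := by
    have : Real.log 8 = 3 * Real.log 2 := by
      rw [show (8 : ℝ) = 2 ^ 3 by norm_num, Real.log_pow]; norm_num
    have h8 : Real.log 8 ≤ Real.log T := Real.log_le_log (by norm_num) hT8
    linarith [Real.log_two_gt_d9]
  have hlogpos : 0 < Real.log T := by linarith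
  set L : ℝ := T / Real.log T ^ 2 with hL
  have hL2 : 2 * Real.log T ^ 2 ≤ T := by
    rw [one_mul, add_zero, div_le_iff₀ hTpos] at h3
    linarith
  have hLge : 2 ≤ L := by
    rw [hL, le_div_iff₀ (by positivity)]
    linarith
  have hL1T : L + 1 ≤ T := by
    have : L ≤ T / 2 := by
      rw [hL]
      exact div_le_div_of_nonneg_left hTpos.le (by norm_num) (by nlinarith)
    linarith
  have hb := AH.card_pairs_offWindow_le hC₀.le hW hTpos.le hA hcl hoff
  have hNL : (zetaZeroCount (L + 1) : ℝ) ≤ CN * ((L + 1) * Real.log (L + 1)) :=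
    hN (L + 1) (by linarith)
  have hlogL : Real.log (L + 1) ≤ Real.log T := Real.log_le_log (by linarith) hL1T
  have hlogT4 : Real.log (T + 4) ≤ 2 * Real.log T := by
    rw [show 2 * Real.log T = Real.log (T ^ 2) by rw [Real.log_pow]; norm_num]
    exact Real.log_le_log (by linarith) (by nlinarith)
  have hLT : (L + 1) * Real.log T ^ 2 ≤ 2 * T := by
    have : L * Real.log T ^ 2 = T := by
      rw [hL]; field_simp
    nlinarith [sq_nonneg (Real.log T)]
  have hlogL0 : 0 ≤ Real.log (L + 1) := Real.log_nonneg (by linarith)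
  have hlog4 : 0 ≤ Real.log (T + 4) := Real.log_nonneg (by linarith)
  have hT4 : 0 ≤ 3 * C₀ * Real.log (T + 4) := by positivity
  have hNL0 : 0 ≤ CN * ((L + 1) * Real.log (L + 1)) :=
    mul_nonneg hCN.le (mul_nonneg (by linarith) hlogL0)
  calc (A.card : ℝ)
      ≤ zetaZeroCount (L + 1) * (3 * C₀ * Real.log (T + 4)) := hb
    _ ≤ CN * ((L + 1) * Real.log (L + 1)) * (3 * C₀ * (2 * Real.log T)) :=
        mul_le_mul hNL (by gcongr) hT4 hNL0
    _ ≤ CN * ((L + 1) * Real.log T) * (3 * C₀ * (2 * Real.log T)) := by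
        gcongr
    _ = 6 * CN * C₀ * ((L + 1) * Real.log T ^ 2) := by ring
    _ ≤ 6 * CN * C₀ * (2 * T) := by gcongr
    _ = 12 * CN * C₀ * T := by ring

/-! ### A2. The pair sum `Σ₀ = L·𝒮(T, M)` and its window version -/

/-- `(γ − γ')·L = ((γ − γ')/2π) log T`: GLSS's normalised difference is BGSTB's.
[cite: GoldstonLeeSchettlerSuriajaya2026, §1 eq. (1.1)] -/
theorem sub_mul_L (T : ℝ) (p : ℕ × ℕ) :
    (zetaOrdinate p.1 - zetaOrdinate p.2) * L T = AH.pairSpacing T p := by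
  unfold L AH.pairSpacing
  ring

open scoped Classical in
/-- The pairs `0 < γ, γ' ≤ T` with `|(γ − γ')L| ≤ M` (all heights; the window of `𝒮(T, M)`). [cite: GoldstonLeeSchettlerSuriajaya2026, §3 eq. (3.1)] -/
def closePairs (T M : ℝ) : Finset (ℕ × ℕ) :=
  (zeroIndexSet T ×ˢ zeroIndexSet T).filter fun p ↦ |AH.pairSpacing T p| ≤ M

open scoped Classical in
/-- Membership in `closePairs`. [cite: GoldstonLeeSchettlerSuriajaya2026, §3 eq. (3.1)] -/
theorem mem_closePairs {T M : ℝ} {p : ℕ × ℕ} :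
    p ∈ closePairs T M ↔ p ∈ zeroIndexSet T ×ˢ zeroIndexSet T ∧ |AH.pairSpacing T p| ≤ M := by
  simp [closePairs]

/-- `𝒫(T, M) ⊆ closePairs T M`. [cite: GoldstonLeeSchettlerSuriajaya2026, §1 (P(T,M))] -/
theorem pairs_subset_closePairs (T M : ℝ) : AH.pairs T M ⊆ closePairs T M := by
  intro p hp
  rw [AH.mem_pairs] at hp
  exact mem_closePairs.mpr ⟨hp.1, hp.2.2.2⟩

open scoped Classical in
/-- **`L · 𝒮(T, M) = Σ_{|x_p| ≤ M} (M − |x_p|)`** (`x_p = (γ − γ')L`, `T > 1`).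
[cite: GoldstonLeeSchettlerSuriajaya2026, §3 eq. (3.1)] -/
theorem L_mul_secondMomentSum {T : ℝ} (hT : 1 < T) (M : ℝ) :
    L T * secondMomentSum T M = ∑ p ∈ closePairs T M, (M - |AH.pairSpacing T p|) := by
  have hL : 0 < L T := L_pos hT
  unfold secondMomentSum closePairs
  rw [Finset.mul_sum]
  have hfilt : ((zeroIndexSet T ×ˢ zeroIndexSet T).filter
      fun p ↦ |(zetaOrdinate p.1 - zetaOrdinate p.2) * L T| ≤ M) =
      (zeroIndexSet T ×ˢ zeroIndexSet T).filter fun p ↦ |AH.pairSpacing T p| ≤ M := by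
    refine Finset.filter_congr fun p _ ↦ ?_
    rw [sub_mul_L]
  rw [hfilt]
  refine Finset.sum_congr rfl fun p _ ↦ ?_
  have h1 : |AH.pairSpacing T p| = |zetaOrdinate p.1 - zetaOrdinate p.2| * L T := by
    rw [← sub_mul_L, abs_mul, abs_of_pos hL]
  rw [h1]
  field_simp

open scoped Classical in
/-- **The switch to the window `γ, γ' > T/log²T`** (GLSS (switch) with `f(u) = M/L − |u|`,
`h = M`): for `M ≥ 0` there are `C, T₀` with
`0 ≤ Σ_{|x_p|≤M} (M − |x_p|) − Σ_{p ∈ 𝒫(T,M)} (M − |x_p|) ≤ C·M·T` for `T ≥ T₀` (the dropped pairs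
have a member `≤ T/log²T` and `|γ − γ'| ≤ M/L ≤ 1`). [cite: GoldstonLeeSchettlerSuriajaya2026, §2 eq. (2.1) and §4 (first display)] -/
theorem exists_switch_le {M : ℝ} (hM : 0 ≤ M) :
    ∃ C T₀ : ℝ, 0 ≤ C ∧ ∀ T : ℝ, T₀ ≤ T →
      0 ≤ ∑ p ∈ closePairs T M, (M - |AH.pairSpacing T p|) -
          ∑ p ∈ AH.pairs T M, (M - |AH.pairSpacing T p|) ∧
      ∑ p ∈ closePairs T M, (M - |AH.pairSpacing T p|) -
          ∑ p ∈ AH.pairs T M, (M - |AH.pairSpacing T p|) ≤ C * M * T := by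
  classical
  obtain ⟨C, T₀, hC, h⟩ := exists_card_offWindow_le
  -- `L T ≥ M` and `T > 1` eventually
  have hLt : Tendsto L atTop atTop :=
    Real.tendsto_log_atTop.atTop_div_const (by positivity)
  obtain ⟨T₁, hT₁⟩ := Filter.eventually_atTop.mp
    ((hLt.eventually_ge_atTop M).and (eventually_gt_atTop (1 : ℝ)))
  refine ⟨C, max T₀ T₁, hC, fun T hT ↦ ?_⟩
  have hTT₀ : T₀ ≤ T := le_trans (le_max_left _ _) hT
  obtain ⟨hLM, hT1⟩ := hT₁ T (le_trans (le_max_right _ _) hT)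
  have hL : 0 < L T := L_pos hT1
  -- the difference is the sum over the dropped pairs
  set D := closePairs T M \ AH.pairs T M with hD
  have hsplit : ∑ p ∈ closePairs T M, (M - |AH.pairSpacing T p|) -
      ∑ p ∈ AH.pairs T M, (M - |AH.pairSpacing T p|) =
      ∑ p ∈ D, (M - |AH.pairSpacing T p|) := by
    rw [hD, Finset.sum_sdiff_eq_sub (pairs_subset_closePairs T M)]
  rw [hsplit]
  have hterm : ∀ p ∈ D, 0 ≤ M - |AH.pairSpacing T p| ∧ M - |AH.pairSpacing T p| ≤ M := by
    intro p hp
    have hp' := (Finset.mem_sdiff.mp hp).1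
    rw [mem_closePairs] at hp'
    exact ⟨by linarith [hp'.2], by linarith [abs_nonneg (AH.pairSpacing T p)]⟩
  refine ⟨Finset.sum_nonneg fun p hp ↦ (hterm p hp).1, ?_⟩
  have hcard : (D.card : ℝ) ≤ C * T := by
    refine h T hTT₀ D ?_ ?_ ?_
    · intro p hp
      exact (mem_closePairs.mp (Finset.mem_sdiff.mp hp).1).1
    · intro p hp
      have hx := (mem_closePairs.mp (Finset.mem_sdiff.mp hp).1).2
      have h1 : |AH.pairSpacing T p| = |zetaOrdinate p.1 - zetaOrdinate p.2| * L T := by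
        rw [← sub_mul_L, abs_mul, abs_of_pos hL]
      rw [h1] at hx
      by_contra hcon
      push Not at hcon
      have : M < |zetaOrdinate p.1 - zetaOrdinate p.2| * L T := by
        calc M ≤ L T := hLM
          _ = 1 * L T := (one_mul _).symm
          _ < |zetaOrdinate p.1 - zetaOrdinate p.2| * L T := mul_lt_mul_of_pos_right hcon hL
      linarith
    · intro p hp
      obtain ⟨hpc, hnp⟩ := Finset.mem_sdiff.mp hp
      rw [mem_closePairs] at hpc
      rw [AH.mem_pairs] at hnp
      by_contra hcon
      push Not at hcon
      exact hnp ⟨hpc.1, hcon.1, hcon.2, hpc.2⟩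
  calc ∑ p ∈ D, (M - |AH.pairSpacing T p|) ≤ ∑ p ∈ D, M :=
        Finset.sum_le_sum fun p hp ↦ (hterm p hp).2
    _ = D.card * M := by rw [Finset.sum_const, nsmul_eq_mul]
    _ ≤ C * T * M := by gcongr
    _ = C * M * T := by ring


/-! ### B1. The bin index of a pair and the partition of `𝒫(T, M)` into the bins `|k| ≤ 2M` -/

/-- The index `k` of the bin `B_{k/2}` (half-width `1/4`) containing the normalised difference
`x = ((γ − γ')/2π) log T` of the pair `p`: `k/2 − 1/4 < x ≤ k/2 + 1/4` iff `k = ⌈2x − 1/2⌉`.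
[cite: GoldstonLeeSchettlerSuriajaya2026, §1 eq. (1.10)] -/
def binIndex (T : ℝ) (p : ℕ × ℕ) : ℤ :=
  ⌈2 * AH.pairSpacing T p - 1 / 2⌉

/-- A pair of `B_{k/2}(T, M, ½)` has bin index `k`. [cite: GoldstonLeeSchettlerSuriajaya2026, §1 eq. (1.10)] -/
theorem binIndex_eq_of_mem_bin {k : ℤ} {T M : ℝ} {p : ℕ × ℕ} (hp : p ∈ AH.bin k T M (1 / 2)) :
    binIndex T p = k := by
  obtain ⟨-, h1, h2⟩ := AH.mem_bin.mp hp
  rw [binIndex, Int.ceil_eq_iff]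
  constructor <;> linarith

/-- Every pair of `𝒫(T, M)` lies in the bin of its index ("`B_{k/2}(T)` … partitions `𝒫(T, M)`").
[cite: GoldstonLeeSchettlerSuriajaya2026, §1 eq. (1.10)] -/
theorem mem_bin_binIndex {T M : ℝ} {p : ℕ × ℕ} (hp : p ∈ AH.pairs T M) :
    p ∈ AH.bin (binIndex T p) T M (1 / 2) := by
  rw [AH.mem_bin]
  have h1 := Int.le_ceil (2 * AH.pairSpacing T p - 1 / 2)
  have h2 := Int.ceil_lt_add_one (2 * AH.pairSpacing T p - 1 / 2)
  refine ⟨hp, ?_, ?_⟩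
  · unfold binIndex
    linarith
  · unfold binIndex
    linarith

/-- The bin index of a pair of `𝒫(T, M)` (`M` a natural number) satisfies `|k| ≤ 2M` ("partitions
`𝒫(T, M)` over `|k| ≤ 2M`"). [cite: GoldstonLeeSchettlerSuriajaya2026, §1 eq. (1.10)] -/
theorem abs_binIndex_le {T : ℝ} {M : ℕ} {p : ℕ × ℕ} (hp : p ∈ AH.pairs T (M : ℝ)) :
    |binIndex T p| ≤ 2 * (M : ℤ) := by
  have hx := abs_le.mp (AH.mem_pairs.mp hp).2.2.2
  have h1 := Int.le_ceil (2 * AH.pairSpacing T p - 1 / 2)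
  have h2 := Int.ceil_lt_add_one (2 * AH.pairSpacing T p - 1 / 2)
  rw [abs_le]
  have hu : (binIndex T p : ℝ) < 2 * (M : ℝ) + 1 := by unfold binIndex; linarith [hx.2]
  have hl : -(2 * (M : ℝ)) - 1 < (binIndex T p : ℝ) := by unfold binIndex; linarith [hx.1]
  have hu' : binIndex T p < 2 * (M : ℤ) + 1 := by exact_mod_cast hu
  have hl' : -(2 * (M : ℤ)) - 1 < binIndex T p := by exact_mod_cast hl
  constructor <;> omega

/-- Distinct bins are disjoint. [cite: GoldstonLeeSchettlerSuriajaya2026, §1 eq. (1.10)] -/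
theorem disjoint_bin {k k' : ℤ} (hk : k ≠ k') (T M : ℝ) :
    Disjoint (AH.bin k T M (1 / 2)) (AH.bin k' T M (1 / 2)) :=
  Finset.disjoint_left.mpr fun _ h h' ↦ hk ((binIndex_eq_of_mem_bin h).symm.trans
    (binIndex_eq_of_mem_bin h'))

/-- The four bins attached to `j ≥ 1`: `B_{±(j−½)}` and `B_{±j}`. [cite: GoldstonLeeSchettlerSuriajaya2026, §4 eq. (4.1)] -/
def quad (T : ℝ) (M : ℕ) (j : ℕ) : Finset (ℕ × ℕ) :=
  AH.bin (2 * (j : ℤ) - 1) T M (1 / 2) ∪ AH.bin (-(2 * (j : ℤ) - 1)) T M (1 / 2) ∪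
    (AH.bin (2 * (j : ℤ)) T M (1 / 2) ∪ AH.bin (-(2 * (j : ℤ))) T M (1 / 2))

/-- Membership in `quad`. [cite: GoldstonLeeSchettlerSuriajaya2026, §4 eq. (4.1)] -/
theorem mem_quad {T : ℝ} {M j : ℕ} {p : ℕ × ℕ} :
    p ∈ quad T M j ↔ p ∈ AH.bin (2 * (j : ℤ) - 1) T M (1 / 2) ∨
      p ∈ AH.bin (-(2 * (j : ℤ) - 1)) T M (1 / 2) ∨
      p ∈ AH.bin (2 * (j : ℤ)) T M (1 / 2) ∨ p ∈ AH.bin (-(2 * (j : ℤ))) T M (1 / 2) := by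
  simp only [quad, Finset.mem_union, or_assoc]

/-- A pair of `quad T M j` has bin index of absolute value `2j − 1` or `2j`. [cite: GoldstonLeeSchettlerSuriajaya2026, §4 eq. (4.1)] -/
theorem natAbs_binIndex_of_mem_quad {T : ℝ} {M j : ℕ} (hj : 1 ≤ j) {p : ℕ × ℕ}
    (hp : p ∈ quad T M j) :
    (binIndex T p).natAbs = 2 * j - 1 ∨ (binIndex T p).natAbs = 2 * j := by
  rcases mem_quad.mp hp with h | h | h | h <;> rw [binIndex_eq_of_mem_bin h] <;> omega

/-- **`𝒫(T, M) = B_0 ∪ ⋃_{1 ≤ j ≤ M} (B_{±(j−½)} ∪ B_{±j})`** (`M` a natural number).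
[cite: GoldstonLeeSchettlerSuriajaya2026, §4 eq. (4.1)] -/
theorem pairs_eq_bin_zero_union {T : ℝ} {M : ℕ} :
    AH.pairs T (M : ℝ) = AH.bin 0 T M (1 / 2) ∪ (Finset.Icc 1 M).biUnion (quad T M) := by
  ext p
  simp only [Finset.mem_union, Finset.mem_biUnion, Finset.mem_Icc]
  constructor
  · intro hp
    have hb := mem_bin_binIndex hp
    have habs := abs_binIndex_le hp
    set k := binIndex T p with hk
    obtain ⟨m, hm⟩ := Nat.even_or_odd' k.natAbs
    have hkabs : (k.natAbs : ℤ) ≤ 2 * (M : ℤ) := by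
      rw [← Int.abs_eq_natAbs]
      exact habs
    have hkM : k.natAbs ≤ 2 * M := by exact_mod_cast hkabs
    rcases Int.natAbs_eq k with hpos | hneg
    · -- `k = natAbs k ≥ 0`
      rcases hm with hm | hm
      · -- even
        by_cases hm0 : m = 0
        · left
          rw [hpos, hm, hm0] at hb
          simpa using hb
        · right
          refine ⟨m, ⟨by omega, by omega⟩, ?_⟩
          rw [mem_quad]
          right; right; left
          rw [hpos, hm] at hb
          push_cast at hb
          exact hb
      · -- odd: `k = 2m + 1 = 2(m+1) − 1`
        right
        refine ⟨m + 1, ⟨by omega, by omega⟩, ?_⟩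
        rw [mem_quad]
        left
        rw [hpos, hm] at hb
        push_cast at hb
        have e : (2 * (m : ℤ) + 1 : ℤ) = 2 * ((m + 1 : ℕ) : ℤ) - 1 := by push_cast; ring
        rw [e] at hb
        exact hb
    · -- `k = −natAbs k ≤ 0`
      rcases hm with hm | hm
      · by_cases hm0 : m = 0
        · left
          rw [hneg, hm, hm0] at hb
          simpa using hb
        · right
          refine ⟨m, ⟨by omega, by omega⟩, ?_⟩
          rw [mem_quad]
          right; right; right
          rw [hneg, hm] at hb
          push_cast at hb
          exact hb
      · right
        refine ⟨m + 1, ⟨by omega, by omega⟩, ?_⟩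
        rw [mem_quad]
        right; left
        rw [hneg, hm] at hb
        push_cast at hb
        have e : (-(2 * (m : ℤ) + 1) : ℤ) = -(2 * ((m + 1 : ℕ) : ℤ) - 1) := by push_cast; ring
        rw [e] at hb
        exact hb
  · rintro (h | ⟨j, -, hj⟩)
    · exact AH.bin_subset_pairs _ _ _ _ h
    · rcases mem_quad.mp hj with h | h | h | h <;> exact AH.bin_subset_pairs _ _ _ _ h

/-- `B_0` is disjoint from the shells `quad T M j`, `j ≥ 1`. [cite: GoldstonLeeSchettlerSuriajaya2026, §4 eq. (4.1)] -/
theorem disjoint_bin_zero_biUnion_quad {T : ℝ} {M : ℕ} :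
    Disjoint (AH.bin 0 T M (1 / 2)) ((Finset.Icc 1 M).biUnion (quad T M)) := by
  rw [Finset.disjoint_biUnion_right]
  intro j hj
  rw [Finset.mem_Icc] at hj
  refine Finset.disjoint_left.mpr fun p h0 hq ↦ ?_
  have h1 := binIndex_eq_of_mem_bin h0
  rcases natAbs_binIndex_of_mem_quad hj.1 hq with h | h <;> rw [h1] at h <;> omega

/-- The shells `quad T M j` are pairwise disjoint. [cite: GoldstonLeeSchettlerSuriajaya2026, §4 eq. (4.1)] -/
theorem pairwiseDisjoint_quad {T : ℝ} {M : ℕ} :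
    ((Finset.Icc 1 M : Finset ℕ) : Set ℕ).PairwiseDisjoint (quad T M) := by
  intro j hj j' hj' hne
  have hj1 : 1 ≤ j := (Finset.mem_Icc.mp hj).1
  have hj'1 : 1 ≤ j' := (Finset.mem_Icc.mp hj').1
  refine Finset.disjoint_left.mpr fun p h h' ↦ hne ?_
  rcases natAbs_binIndex_of_mem_quad hj1 h with h1 | h1 <;>
    rcases natAbs_binIndex_of_mem_quad hj'1 h' with h2 | h2 <;> omega

/-- The sum over a shell splits into its four bins. [cite: GoldstonLeeSchettlerSuriajaya2026, §4 eq. (4.1)] -/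
theorem sum_quad {T : ℝ} {M j : ℕ} (hj : 1 ≤ j) (f : ℕ × ℕ → ℝ) :
    ∑ p ∈ quad T M j, f p =
      ∑ p ∈ AH.bin (2 * (j : ℤ) - 1) T M (1 / 2), f p +
        ∑ p ∈ AH.bin (-(2 * (j : ℤ) - 1)) T M (1 / 2), f p +
      (∑ p ∈ AH.bin (2 * (j : ℤ)) T M (1 / 2), f p +
        ∑ p ∈ AH.bin (-(2 * (j : ℤ))) T M (1 / 2), f p) := by
  unfold quad
  rw [Finset.sum_union, Finset.sum_union (disjoint_bin (by omega) _ _),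
    Finset.sum_union (disjoint_bin (by omega) _ _)]
  rw [Finset.disjoint_union_left, Finset.disjoint_union_right, Finset.disjoint_union_right]
  exact ⟨⟨disjoint_bin (by omega) _ _, disjoint_bin (by omega) _ _⟩,
    disjoint_bin (by omega) _ _, disjoint_bin (by omega) _ _⟩

/-- **Partition of a sum over `𝒫(T, M)` along the bins.** [cite: GoldstonLeeSchettlerSuriajaya2026, §4 eq. (4.1)] -/
theorem sum_pairs_eq {T : ℝ} {M : ℕ} (f : ℕ × ℕ → ℝ) :
    ∑ p ∈ AH.pairs T (M : ℝ), f p =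
      ∑ p ∈ AH.bin 0 T M (1 / 2), f p +
        ∑ j ∈ Finset.Icc 1 M,
          (∑ p ∈ AH.bin (2 * (j : ℤ) - 1) T M (1 / 2), f p +
              ∑ p ∈ AH.bin (-(2 * (j : ℤ) - 1)) T M (1 / 2), f p +
            (∑ p ∈ AH.bin (2 * (j : ℤ)) T M (1 / 2), f p +
              ∑ p ∈ AH.bin (-(2 * (j : ℤ))) T M (1 / 2), f p)) := by
  rw [pairs_eq_bin_zero_union, Finset.sum_union disjoint_bin_zero_biUnion_quad,
    Finset.sum_biUnion pairwiseDisjoint_quad]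
  congr 1
  exact Finset.sum_congr rfl fun j hj ↦ sum_quad (Finset.mem_Icc.mp hj).1 f

/-! ### B2. AH-Pairs: every pair is near the centre of its bin; the bins are swap-symmetric -/

/-- Under an AH-Pairs witness `(R, C)` at level `M ≥ 0`: for all large `T`, every pair of `𝒫(T, M)`
is within `|C|(4M + 2)R(T) < 1/8` of the centre `k/2` of ITS bin ("`(γ − γ')L = k/2 +
O((|k| + 1)R(T))`" with `|k| ≤ 4M + 1`, and the approximating half-integer is the bin's once the
error is `< 1/4`). [cite: GoldstonLeeSchettlerSuriajaya2026, §4 (first display of the proof of Theorem 2)] -/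
theorem eventually_abs_sub_binIndex_le {M : ℝ} (hM : 0 ≤ M) {R : ℝ → ℝ} {C : ℝ}
    (h : IsAHPairsWitness M R C) :
    ∀ᶠ T : ℝ in atTop, |C| * (4 * M + 2) * R T < 1 / 8 ∧ ∀ p ∈ AH.pairs T M,
      |AH.pairSpacing T p - (binIndex T p : ℝ) / 2| ≤ |C| * (4 * M + 2) * R T := by
  obtain ⟨hR0, -, hRt, hev⟩ := h
  have hsmall : ∀ᶠ T : ℝ in atTop, |C| * (4 * M + 2) * R T < 1 / 8 := by
    have : Tendsto (fun T ↦ |C| * (4 * M + 2) * R T) atTop (𝓝 0) := by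
      simpa using hRt.const_mul (|C| * (4 * M + 2))
    exact this.eventually (gt_mem_nhds (by norm_num))
  filter_upwards [hev, hsmall] with T hT hsT
  refine ⟨hsT, fun p hp ↦ ?_⟩
  obtain ⟨k, hk⟩ := hT p hp
  have hRT : 0 ≤ R T := (hR0 T).le
  have hx : |AH.pairSpacing T p| ≤ M := (AH.mem_pairs.mp hp).2.2.2
  set x := AH.pairSpacing T p with hxdef
  have hk' : |x - k / 2| ≤ |C| * (|(k : ℝ)| + 1) * R T :=
    hk.trans (by gcongr; exact le_abs_self C)
  have hCR : |C| * R T ≤ 1 / 4 := by nlinarith [abs_nonneg C]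
  -- `|k| ≤ 4M + 1`
  have hkabs : |(k : ℝ)| ≤ 4 * M + 1 := by
    have h1 : |(k : ℝ) / 2| ≤ |x| + |x - k / 2| := by
      have := abs_sub_abs_le_abs_sub ((k : ℝ) / 2) x
      rw [abs_sub_comm] at this
      linarith
    rw [abs_div, abs_two] at h1
    have h2 : |C| * (|(k : ℝ)| + 1) * R T ≤ (|(k : ℝ)| + 1) * (1 / 4) := by
      calc |C| * (|(k : ℝ)| + 1) * R T = (|(k : ℝ)| + 1) * (|C| * R T) := by ring
        _ ≤ (|(k : ℝ)| + 1) * (1 / 4) := by gcongr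
    linarith
  have hnear : |x - k / 2| ≤ |C| * (4 * M + 2) * R T := by
    have hk1 : |(k : ℝ)| + 1 ≤ 4 * M + 2 := by linarith
    exact hk'.trans
      (mul_le_mul_of_nonneg_right (mul_le_mul_of_nonneg_left hk1 (abs_nonneg C)) hRT)
  -- the approximating half-integer is the bin's
  have hmem : p ∈ AH.bin k T M (1 / 2) := by
    rw [AH.mem_bin]
    obtain ⟨h1, h2⟩ := abs_le.mp hnear
    refine ⟨hp, ?_, ?_⟩ <;> linarith
  rw [binIndex_eq_of_mem_bin hmem]
  exact hnear

/-- `𝒫(T, M)` is invariant under the swap `(γ, γ') ↦ (γ', γ)`. [cite: BaluyotGoldstonSuriajayaTurnageButterbaugh2025, §1 (P(T,M))] -/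
theorem swap_mem_pairs {T M : ℝ} {p : ℕ × ℕ} (hp : p ∈ AH.pairs T M) : p.swap ∈ AH.pairs T M := by
  rw [AH.mem_pairs] at hp ⊢
  obtain ⟨hpS, h1, h2, h3⟩ := hp
  rw [Finset.mem_product] at hpS ⊢
  refine ⟨⟨hpS.2, hpS.1⟩, h2, h1, ?_⟩
  rw [AH.pairSpacing_swap, abs_neg]
  exact h3

/-- **Swap symmetry of the bins away from the edges**: if every pair of `𝒫(T, M)` is within
`r < 1/4` of the centre of its bin (no pair on a bin edge), then `|B_{−k/2}| = |B_{k/2}|` for every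
`k` ("for all `k ∈ ℤ` we have `P_{k/2} = P_{−k/2}`"). [cite: GoldstonLeeSchettlerSuriajaya2026, §1 (footnote to (1.11))] -/
theorem card_bin_neg_eq {T M r : ℝ} (hr : r < 1 / 4)
    (hnear : ∀ p ∈ AH.pairs T M, |AH.pairSpacing T p - (binIndex T p : ℝ) / 2| ≤ r) (k : ℤ) :
    (AH.bin (-k) T M (1 / 2)).card = (AH.bin k T M (1 / 2)).card := by
  -- the swap maps `B_{k/2}` into `B_{−k/2}`, for every `k`
  have hmap : ∀ k : ℤ, ∀ p ∈ AH.bin k T M (1 / 2), p.swap ∈ AH.bin (-k) T M (1 / 2) := by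
    intro k p hp
    have hpP := (AH.mem_bin.mp hp).1
    have hx := hnear p hpP
    rw [binIndex_eq_of_mem_bin hp] at hx
    obtain ⟨h1, h2⟩ := abs_le.mp hx
    rw [AH.mem_bin, AH.pairSpacing_swap]
    refine ⟨swap_mem_pairs hpP, ?_, ?_⟩ <;> push_cast <;> linarith
  have hle : ∀ k : ℤ, (AH.bin k T M (1 / 2)).card ≤ (AH.bin (-k) T M (1 / 2)).card := by
    intro k
    calc (AH.bin k T M (1 / 2)).card
        = ((AH.bin k T M (1 / 2)).image Prod.swap).card :=
          (Finset.card_image_of_injective _ Prod.swap_injective).symm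
      _ ≤ (AH.bin (-k) T M (1 / 2)).card :=
          Finset.card_le_card (Finset.image_subset_iff.mpr (hmap k))
  refine le_antisymm ?_ (hle k)
  have := hle (-k)
  rwa [neg_neg] at this

/-! ### B3. The weighted bin sum of the proof of Theorem 2 -/

/-- The model weight `M − |k(p)|/2` of a pair, `k(p)` its bin index (the value of `M − |x_p|` at the
centre of the bin of `p`). [cite: GoldstonLeeSchettlerSuriajaya2026, §4 eq. (4.1)] -/
def model (T : ℝ) (M : ℕ) (p : ℕ × ℕ) : ℝ :=
  (M : ℝ) - |(binIndex T p : ℝ)| / 2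

/-- On `B_{k/2}` the model weight is the constant `M − |k|/2`. [cite: GoldstonLeeSchettlerSuriajaya2026, §4 eq. (4.1)] -/
theorem sum_model_bin (T : ℝ) (M : ℕ) (k : ℤ) :
    ∑ p ∈ AH.bin k T M (1 / 2), model T M p =
      (AH.bin k T M (1 / 2)).card * ((M : ℝ) - |(k : ℝ)| / 2) := by
  rw [Finset.sum_congr rfl fun p hp ↦ (show model T M p = (M : ℝ) - |(k : ℝ)| / 2 by
    rw [model, binIndex_eq_of_mem_bin hp]), Finset.sum_const, nsmul_eq_mul]


/-! ### C. The arithmetic of the proof of Theorem 2: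
`2Σ_{j≤M}(M − j)(1 − 2/(π²(2j−1)²)) = M² − (3/2)M + log M/π² + O(1)` with an explicit `O(1)` -/

/-- `Σ_{i ≥ 0} 1/(2i + 1)² = π²/8` (the odd part of `ζ(2) = π²/6`). [folklore] -/
private theorem hasSum_inv_odd_sq :
    HasSum (fun i : ℕ ↦ 1 / (2 * (i : ℝ) + 1) ^ 2) (π ^ 2 / 8) := by
  set f : ℕ → ℝ := fun n ↦ 1 / (n : ℝ) ^ 2 with hf
  have h : HasSum f (π ^ 2 / 6) := hasSum_zeta_two
  have he : HasSum (fun k : ℕ ↦ f (2 * k)) (π ^ 2 / 24) := by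
    have h4 := h.mul_left (1 / 4)
    have e1 : (fun k : ℕ ↦ f (2 * k)) = fun n ↦ 1 / 4 * f n := by
      funext k
      simp only [hf]
      push_cast
      ring
    rw [e1, show π ^ 2 / 24 = 1 / 4 * (π ^ 2 / 6) by ring]
    exact h4
  have hodd : Summable (fun k : ℕ ↦ f (2 * k + 1)) :=
    h.summable.comp_injective (i := fun k : ℕ ↦ 2 * k + 1) fun a b hab ↦ by
      simpa using hab
  obtain ⟨b, hb⟩ := hodd
  have htot := HasSum.even_add_odd he hb
  have huniq : π ^ 2 / 24 + b = π ^ 2 / 6 := htot.unique h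
  have hb' : b = π ^ 2 / 8 := by linarith
  rw [hb'] at hb
  refine hb.congr_fun fun k ↦ ?_
  simp only [hf]
  push_cast
  ring

/-- `S_M := Σ_{1 ≤ j ≤ M} 1/(2j − 1)²` as a sum over `i = j − 1 < M`. [folklore] -/
private theorem sum_inv_odd_sq_eq_range (M : ℕ) :
    ∑ j ∈ Finset.Icc 1 M, 1 / (2 * (j : ℝ) - 1) ^ 2 =
      ∑ i ∈ Finset.range M, 1 / (2 * (i : ℝ) + 1) ^ 2 := by
  rw [← Finset.Ico_add_one_right_eq_Icc, Finset.sum_Ico_eq_sum_range]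
  simp only [Nat.add_sub_cancel]
  refine Finset.sum_congr rfl fun i _ ↦ ?_
  push_cast
  ring

/-- **`0 ≤ M(π²/8 − S_M) ≤ 1`**: the tail `Σ_{i ≥ M} 1/(2i+1)² ≤ Σ_{i ≥ M} (1/(i+M…))` telescopes to
`≤ 1/M`. [folklore] -/
private theorem sum_inv_odd_sq_bounds {M : ℕ} (hM : 1 ≤ M) :
    0 ≤ π ^ 2 / 8 - ∑ j ∈ Finset.Icc 1 M, 1 / (2 * (j : ℝ) - 1) ^ 2 ∧
      (M : ℝ) * (π ^ 2 / 8 - ∑ j ∈ Finset.Icc 1 M, 1 / (2 * (j : ℝ) - 1) ^ 2) ≤ 1 := by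
  set o : ℕ → ℝ := fun i ↦ 1 / (2 * (i : ℝ) + 1) ^ 2 with ho
  have hsum : HasSum o (π ^ 2 / 8) := hasSum_inv_odd_sq
  have hM0 : (0 : ℝ) < M := by exact_mod_cast hM
  -- the tail `t = Σ' i, o (i + M)`
  have hsplit : ∑ i ∈ Finset.range M, o i + ∑' i, o (i + M) = π ^ 2 / 8 := by
    rw [hsum.summable.sum_add_tsum_nat_add M, hsum.tsum_eq]
  have htail0 : 0 ≤ ∑' i, o (i + M) := tsum_nonneg fun i ↦ by positivity
  -- `o (i + M) ≤ 1/(i+M) − 1/(i+M+1)`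
  have hterm : ∀ i : ℕ, o (i + M) ≤ 1 / ((i : ℝ) + M) - 1 / ((i : ℝ) + M + 1) := by
    intro i
    have hiM : (1 : ℝ) ≤ (i : ℝ) + M := by
      have : (0 : ℝ) ≤ i := Nat.cast_nonneg i
      have : (1 : ℝ) ≤ M := by exact_mod_cast hM
      linarith
    simp only [ho]
    push_cast
    rw [div_sub_div _ _ (by positivity) (by positivity), div_le_div_iff₀ (by positivity) (by positivity)]
    nlinarith
  have htail1 : ∑' i, o (i + M) ≤ 1 / (M : ℝ) := by
    refine tsum_le_of_sum_range_le (fun i ↦ by positivity) fun n ↦ ?_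
    calc ∑ i ∈ Finset.range n, o (i + M)
        ≤ ∑ i ∈ Finset.range n, (1 / ((i : ℝ) + M) - 1 / ((i : ℝ) + M + 1)) :=
          Finset.sum_le_sum fun i _ ↦ hterm i
      _ = 1 / (M : ℝ) - 1 / ((n : ℝ) + M) := by
          have := Finset.sum_range_sub' (fun i : ℕ ↦ 1 / ((i : ℝ) + M)) n
          simp only [Nat.cast_zero, zero_add] at this
          rw [← this]
          refine Finset.sum_congr rfl fun i _ ↦ ?_
          push_cast
          ring
      _ ≤ 1 / (M : ℝ) := by
          have : 0 ≤ 1 / ((n : ℝ) + M) := by positivity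
          linarith
  rw [sum_inv_odd_sq_eq_range]
  have heq : π ^ 2 / 8 - ∑ i ∈ Finset.range M, o i = ∑' i, o (i + M) := by linarith
  rw [heq]
  refine ⟨htail0, ?_⟩
  calc (M : ℝ) * ∑' i, o (i + M) ≤ (M : ℝ) * (1 / M) := by gcongr
    _ = 1 := by field_simp

/-- Odd/even splitting of a sum over `1 ≤ i ≤ 2M`. [folklore] -/
private theorem sum_Icc_two_mul (f : ℕ → ℝ) (M : ℕ) :
    ∑ i ∈ Finset.Icc 1 (2 * M), f i = ∑ j ∈ Finset.Icc 1 M, (f (2 * j - 1) + f (2 * j)) := by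
  induction M with
  | zero => simp
  | succ M ih =>
    have e : 2 * (M + 1) = 2 * M + 1 + 1 := by ring
    rw [e, Finset.sum_Icc_succ_top (by omega), Finset.sum_Icc_succ_top (by omega), ih,
      Finset.sum_Icc_succ_top (by omega)]
    have e1 : 2 * (M + 1) - 1 = 2 * M + 1 := by omega
    rw [e1, ← e]
    ring

/-- **The odd harmonic sum**: `|Σ_{1 ≤ j ≤ M} 1/(2j − 1) − (1/2) log M| ≤ 2` for `M ≥ 1`
(`= H_{2M} − H_M/2` and `log(n+1) ≤ H_n ≤ 1 + log n`). [folklore] -/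
private theorem abs_oddHarmonic_sub_le {M : ℕ} (hM : 1 ≤ M) :
    |∑ j ∈ Finset.Icc 1 M, 1 / (2 * (j : ℝ) - 1) - Real.log M / 2| ≤ 2 := by
  have hM0 : (0 : ℝ) < M := by exact_mod_cast hM
  -- `H_n` over `ℝ`
  have hH : ∀ n : ℕ, ((harmonic n : ℚ) : ℝ) = ∑ i ∈ Finset.Icc 1 n, 1 / (i : ℝ) := by
    intro n
    rw [harmonic_eq_sum_Icc]
    push_cast
    refine Finset.sum_congr rfl fun i _ ↦ ?_
    rw [one_div]
  have hsplit : ∑ i ∈ Finset.Icc 1 (2 * M), 1 / (i : ℝ) =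
      ∑ j ∈ Finset.Icc 1 M, 1 / (2 * (j : ℝ) - 1) + (1 / 2) * ∑ j ∈ Finset.Icc 1 M, 1 / (j : ℝ) := by
    rw [sum_Icc_two_mul (fun i : ℕ ↦ 1 / (i : ℝ)) M, Finset.sum_add_distrib, Finset.mul_sum]
    congr 1
    · refine Finset.sum_congr rfl fun j hj ↦ ?_
      have hj1 : 1 ≤ j := (Finset.mem_Icc.mp hj).1
      have : ((2 * j - 1 : ℕ) : ℝ) = 2 * (j : ℝ) - 1 := by
        rw [Nat.cast_sub (by omega)]; push_cast; ring
      rw [this]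
    · refine Finset.sum_congr rfl fun j hj ↦ ?_
      have hj1 : 1 ≤ j := (Finset.mem_Icc.mp hj).1
      have hj0 : (0 : ℝ) < j := by exact_mod_cast hj1
      push_cast
      field_simp
  have hodd : ∑ j ∈ Finset.Icc 1 M, 1 / (2 * (j : ℝ) - 1) =
      ((harmonic (2 * M) : ℚ) : ℝ) - (1 / 2) * ((harmonic M : ℚ) : ℝ) := by
    rw [hH, hH, hsplit]; ring
  have h1 := harmonic_le_one_add_log (2 * M)
  have h2 := log_add_one_le_harmonic (2 * M)
  have h3 := harmonic_le_one_add_log M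
  have h4 := log_add_one_le_harmonic M
  push_cast at h1 h2 h3 h4
  have hlog2M : Real.log (2 * (M : ℝ)) = Real.log 2 + Real.log M :=
    Real.log_mul (by norm_num) hM0.ne'
  have hlogM1 : Real.log (M : ℝ) ≤ Real.log ((M : ℝ) + 1) := Real.log_le_log hM0 (by linarith)
  have hlog2M1 : Real.log (2 * (M : ℝ)) ≤ Real.log (2 * (M : ℝ) + 1) :=
    Real.log_le_log (by positivity) (by linarith)
  have hl2 := Real.log_two_lt_d9
  have hl2' := Real.log_two_gt_d9
  rw [hodd, abs_le]
  constructor <;> linarith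

/-- `π² < 10`. [folklore] -/
private theorem pi_sq_lt_ten : π ^ 2 < 10 := by
  have := Real.pi_lt_d2
  nlinarith [Real.pi_pos]

/-- **The arithmetic of (4.2)**: for `M ≥ 1`,
`|(3/2)M + 2Σ_{j≤M}(M − j)(1 − 2/(π²(2j−1)²)) − M² − log M/π²| ≤ 2` — GLSS: "`2Σ_{j≤M}(M−j)(1 −
2/(π²(2j−1)²)) = (M² − M) − (M/2 − log M/π² + O(1)) = M² − (3/2)M + log M/π² + O(1)`", here with
the explicit `O(1)` from `Σ_{j≥1}(2j−1)⁻² = π²/8` (tail `≤ 1/M`), `j(2j−1)⁻² = ½((2j−1)⁻¹ +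
(2j−1)⁻²)` and `|Σ_{j≤M}(2j−1)⁻¹ − ½log M| ≤ 2`. [cite: GoldstonLeeSchettlerSuriajaya2026, §4 eq. (4.2) and the display after it] -/
theorem abs_mainTerms_sub_le {M : ℕ} (hM : 1 ≤ M) :
    |3 / 2 * (M : ℝ) + 2 * ∑ j ∈ Finset.Icc 1 M, ((M : ℝ) - j) *
        (1 - 2 / (π ^ 2 * (2 * (j : ℝ) - 1) ^ 2)) - (M : ℝ) ^ 2 - Real.log M / π ^ 2| ≤ 2 := by
  have hπ0 : 0 < π ^ 2 := by positivity
  have hπ9 : 9 < π ^ 2 := by nlinarith [Real.pi_gt_three]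
  have hπ10 := pi_sq_lt_ten
  set S : ℝ := ∑ j ∈ Finset.Icc 1 M, 1 / (2 * (j : ℝ) - 1) ^ 2 with hS
  set Ho : ℝ := ∑ j ∈ Finset.Icc 1 M, 1 / (2 * (j : ℝ) - 1) with hHo
  obtain ⟨ht0, ht1⟩ := sum_inv_odd_sq_bounds hM
  have hHo2 := abs_le.mp (abs_oddHarmonic_sub_le hM)
  have hS0 : 0 ≤ S := Finset.sum_nonneg fun j _ ↦ by positivity
  have hcard : ((Finset.Icc 1 M).card : ℝ) = M := by simp
  -- expand the sum termwise
  have hkey : ∀ j ∈ Finset.Icc 1 M, ((M : ℝ) - j) * (1 - 2 / (π ^ 2 * (2 * (j : ℝ) - 1) ^ 2)) =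
      ((M : ℝ) - j) - 2 / π ^ 2 * (M : ℝ) * (1 / (2 * (j : ℝ) - 1) ^ 2) +
        1 / π ^ 2 * (1 / (2 * (j : ℝ) - 1)) + 1 / π ^ 2 * (1 / (2 * (j : ℝ) - 1) ^ 2) := by
    intro j hj
    have hj1 : (1 : ℝ) ≤ j := by exact_mod_cast (Finset.mem_Icc.mp hj).1
    have hu : (2 * (j : ℝ) - 1) ≠ 0 := by linarith
    have hu2 : (2 * (j : ℝ) - 1) ^ 2 ≠ 0 := pow_ne_zero 2 hu
    have key : 2 * (j : ℝ) / (2 * (j : ℝ) - 1) ^ 2 =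
        1 / (2 * (j : ℝ) - 1) + 1 / (2 * (j : ℝ) - 1) ^ 2 := by
      rw [div_add_div _ _ hu hu2, div_eq_div_iff hu2 (mul_ne_zero hu hu2)]
      ring
    have hπ : (π : ℝ) ^ 2 ≠ 0 := hπ0.ne'
    have e1 : 2 / (π ^ 2 * (2 * (j : ℝ) - 1) ^ 2) = 1 / π ^ 2 * (2 / (2 * (j : ℝ) - 1) ^ 2) := by
      rw [one_div, ← div_eq_inv_mul, div_div, mul_comm]
    rw [e1]
    linear_combination ((M : ℝ) - (M : ℝ) + 1 / π ^ 2) * key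
  have hexp : ∑ j ∈ Finset.Icc 1 M, ((M : ℝ) - j) * (1 - 2 / (π ^ 2 * (2 * (j : ℝ) - 1) ^ 2)) =
      ∑ j ∈ Finset.Icc 1 M, ((M : ℝ) - j) - 2 / π ^ 2 * (M : ℝ) * S + 1 / π ^ 2 * Ho +
        1 / π ^ 2 * S := by
    rw [Finset.sum_congr rfl hkey, Finset.sum_add_distrib, Finset.sum_add_distrib,
      Finset.sum_sub_distrib, ← Finset.mul_sum, ← Finset.mul_sum, ← Finset.mul_sum]
  -- `Σ_{j ≤ M} (M − j) = M(M − 1)/2`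
  have hG : ∀ n : ℕ, ∑ j ∈ Finset.Icc 1 n, (j : ℝ) = (n : ℝ) * (n + 1) / 2 := by
    intro n
    induction n with
    | zero => simp
    | succ n ih =>
      rw [Finset.sum_Icc_succ_top (by omega), ih]
      push_cast
      ring
  have hlin : ∑ j ∈ Finset.Icc 1 M, ((M : ℝ) - j) = ((M : ℝ) ^ 2 - M) / 2 := by
    rw [Finset.sum_sub_distrib, Finset.sum_const, Nat.card_Icc, nsmul_eq_mul, hG M]
    push_cast
    ring
  rw [hexp, hlin]
  -- collect: the expression equals `(2/π²)(Ho − log M/2) + (4/π²) M (π²/8 − S) + (2/π²) S`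
  have hid : 3 / 2 * (M : ℝ) + 2 * (((M : ℝ) ^ 2 - M) / 2 - 2 / π ^ 2 * (M : ℝ) * S +
      1 / π ^ 2 * Ho + 1 / π ^ 2 * S) - (M : ℝ) ^ 2 - Real.log M / π ^ 2 =
      2 / π ^ 2 * (Ho - Real.log M / 2) + 4 / π ^ 2 * ((M : ℝ) * (π ^ 2 / 8 - S)) +
        2 / π ^ 2 * S := by
    field_simp
    ring
  rw [hid]
  have hSle : S ≤ 10 / 8 := by linarith
  have hc1 : 2 / π ^ 2 ≤ 2 / 9 := div_le_div_of_nonneg_left (by norm_num) (by norm_num) hπ9.le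
  have hc2 : 4 / π ^ 2 ≤ 4 / 9 := div_le_div_of_nonneg_left (by norm_num) (by norm_num) hπ9.le
  have hc10 : 0 < 2 / π ^ 2 := by positivity
  have hc20 : 0 < 4 / π ^ 2 := by positivity
  rw [abs_le]
  constructor
  · nlinarith
  · nlinarith


/-! ### D1. `|𝒫(T, M)| ≪_M TL` from (3.2) (GLSS (P_{k/2} sumbound) via (3.2) at `λ = 2M`) -/

/-- `closePairs` grows with the window. [cite: GoldstonLeeSchettlerSuriajaya2026, §3 eq. (3.1)] -/
theorem closePairs_mono (T : ℝ) {M M' : ℝ} (h : M ≤ M') : closePairs T M ⊆ closePairs T M' := by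
  intro p hp
  rw [mem_closePairs] at hp ⊢
  exact ⟨hp.1, hp.2.trans h⟩

/-- **The pair count in a window of `M` mean spacings is `O_M(TL)`**, from (3.2) at `λ = 2M`: the
pairs with `|x_p| ≤ M` contribute `≥ M/L` each to `𝒮(T, 2M) = O_M(T)`. (GLSS obtain
`|𝒫(T, M)| ≪ MTL` from the cruder (GMbound); here the one named fact suffices.)
[cite: GoldstonLeeSchettlerSuriajaya2026, §1 eq. (1.12) (P_{k/2} sum bound)] -/
theorem exists_eventually_card_closePairs_le (hd : glss2026_dsec2) {M : ℝ} (hM : 0 < M) :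
    ∃ C : ℝ, 0 ≤ C ∧ ∀ᶠ T : ℝ in atTop, ((closePairs T M).card : ℝ) ≤ C * (T * L T) := by
  obtain ⟨A₀, hA⟩ := hd
  set K : ℝ := (2 * M) ^ 2 + Real.log (2 + 2 * M) / π ^ 2 +
    |A₀| * (Real.sqrt (Real.log (2 + 2 * M)) + (2 * M) ^ 2) with hK
  have hlog0 : 0 ≤ Real.log (2 + 2 * M) := Real.log_nonneg (by linarith)
  have hK0 : 0 ≤ K := by positivity
  have hLt : Tendsto L atTop atTop := Real.tendsto_log_atTop.atTop_div_const (by positivity)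
  refine ⟨K / M, by positivity, ?_⟩
  filter_upwards [hA (2 * M) (by positivity), eventually_gt_atTop 1, hLt.eventually_ge_atTop 1]
    with T hT hT1 hL1
  have hL : 0 < L T := L_pos hT1
  have hT0 : 0 < T := by linarith
  -- `M · # ≤ Σ_{|x| ≤ 2M} (2M − |x|) = L · 𝒮(T, 2M)`
  have h1 : M * ((closePairs T M).card : ℝ) ≤
      ∑ p ∈ closePairs T (2 * M), (2 * M - |AH.pairSpacing T p|) := by
    calc M * ((closePairs T M).card : ℝ) = ∑ p ∈ closePairs T M, M := by
          rw [Finset.sum_const, nsmul_eq_mul, mul_comm]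
      _ ≤ ∑ p ∈ closePairs T M, (2 * M - |AH.pairSpacing T p|) :=
          Finset.sum_le_sum fun p hp ↦ by linarith [(mem_closePairs.mp hp).2]
      _ ≤ ∑ p ∈ closePairs T (2 * M), (2 * M - |AH.pairSpacing T p|) :=
          Finset.sum_le_sum_of_subset_of_nonneg (closePairs_mono T (by linarith))
            fun p hp _ ↦ by linarith [(mem_closePairs.mp hp).2]
  rw [← L_mul_secondMomentSum hT1 (2 * M)] at h1
  -- `𝒮(T, 2M) ≤ K · T`
  have h2 : secondMomentSum T (2 * M) ≤ K * T := by
    have h := (abs_le.mp hT).2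
    have hA1 : A₀ * (T * Real.sqrt (Real.log (2 + 2 * M)) + (2 * M) ^ 2 * T / L T) ≤
        |A₀| * (T * Real.sqrt (Real.log (2 + 2 * M)) + (2 * M) ^ 2 * T / L T) :=
      mul_le_mul_of_nonneg_right (le_abs_self A₀) (by positivity)
    have hfrac : (2 * M) ^ 2 * T / L T ≤ (2 * M) ^ 2 * T := by
      rw [div_le_iff₀ hL]
      have : (2 * M) ^ 2 * T * 1 ≤ (2 * M) ^ 2 * T * L T :=
        mul_le_mul_of_nonneg_left hL1 (by positivity)
      linarith
    have hA2 : |A₀| * (T * Real.sqrt (Real.log (2 + 2 * M)) + (2 * M) ^ 2 * T / L T) ≤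
        |A₀| * (T * Real.sqrt (Real.log (2 + 2 * M)) + (2 * M) ^ 2 * T) := by
      gcongr
    have hK' : K * T = (2 * M) ^ 2 * T + T / π ^ 2 * Real.log (2 + 2 * M) +
        |A₀| * (T * Real.sqrt (Real.log (2 + 2 * M)) + (2 * M) ^ 2 * T) := by
      rw [hK]; ring
    rw [hK']
    linarith
  -- conclude
  have h3 : M * ((closePairs T M).card : ℝ) ≤ L T * (K * T) :=
    h1.trans (mul_le_mul_of_nonneg_left h2 hL.le)
  rw [div_mul_eq_mul_div, le_div_iff₀ hM]
  linarith

/-! ### D2. Assembly: Theorem 2 from (3.2) -/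

/-- `√(a + 1) ≤ √a + 1` for `a ≥ 0`. [folklore] -/
private theorem sqrt_add_one_le {a : ℝ} (ha : 0 ≤ a) : Real.sqrt (a + 1) ≤ Real.sqrt a + 1 := by
  have h1 : a + 1 ≤ (Real.sqrt a + 1) ^ 2 := by
    nlinarith [Real.sq_sqrt ha, Real.sqrt_nonneg a]
  calc Real.sqrt (a + 1) ≤ Real.sqrt ((Real.sqrt a + 1) ^ 2) := Real.sqrt_le_sqrt h1
    _ = Real.sqrt a + 1 := Real.sqrt_sq (by positivity)

/-- The weight `M − |x_p|` is within `r` of the model weight `M − |k(p)|/2` when `|x_p − k(p)/2| ≤ r`.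
[cite: GoldstonLeeSchettlerSuriajaya2026, §4 eq. (4.1)] -/
private theorem abs_weight_sub_model_le {T : ℝ} {M : ℕ} {p : ℕ × ℕ} {r : ℝ}
    (h : |AH.pairSpacing T p - (binIndex T p : ℝ) / 2| ≤ r) :
    |((M : ℝ) - |AH.pairSpacing T p|) - model T M p| ≤ r := by
  unfold model
  have h1 := abs_abs_sub_abs_le_abs_sub ((binIndex T p : ℝ) / 2) (AH.pairSpacing T p)
  rw [abs_sub_comm ((binIndex T p : ℝ) / 2)] at h1
  rw [abs_div, abs_two] at h1
  have e : ((M : ℝ) - |AH.pairSpacing T p|) - ((M : ℝ) - |(binIndex T p : ℝ)| / 2) =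
      |(binIndex T p : ℝ)| / 2 - |AH.pairSpacing T p| := by ring
  rw [e]
  exact h1.trans h

/-- `9 < π²`. [folklore] -/
private theorem nine_lt_pi_sq : (9 : ℝ) < π ^ 2 := by
  have h := Real.pi_gt_three
  nlinarith

end GLSS2026

set_option maxHeartbeats 400000 in
open GLSS2026 in
/-- **GLSS 2026, Theorem 2 from display (3.2)** (the printed proof, §4). With `x_p = (γ − γ')L` and
`M ≥ 4` even, AH-Pairs data `(R, C)` at level `M`: (switch) `L·𝒮(T, M) = Σ_{|x_p|≤M}(M − |x_p|) =
Σ_{p ∈ 𝒫(T,M)} (M − |x_p|) + O_M(T)` (`exists_switch_le`); by AH-Pairs every pair of `𝒫(T, M)` is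
within `r(T) = |C|(4M+2)R(T)` of the centre `k/2` of its bin, `|k| ≤ 2M`, no pair on a bin edge, so
`Σ_{𝒫}(M − |x_p|) = Σ_{|k|≤2M} |B_{k/2}|(M − |k|/2) + O(r|𝒫|)` with `|B_{−k/2}| = |B_{k/2}|` and
`|𝒫(T, M)| = O_M(TL)` (from (3.2) at `2M`), i.e. `= TL·(MP_0 + 2Σ_j(M−j)(P_{j−½} + P_j) + Σ_j P_{j−½})
+ o_M(TL)` — display (4.1); (3.2) at `λ = M` gives `𝒮(T,M)/T = M² + log(2+M)/π² + O(√log(2+M)) +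
O(M²/L)` — display (4.2) — and `(3/2)M + 2Σ_j(M−j)(1 − 2/(π²(2j−1)²)) = M² + log M/π² + O(1)`
(`abs_mainTerms_sub_le`). TYPING NOTE: in the typed statement the threshold in `T` follows `M, R, C`
(as in the printed proof: AH-Pairs "for sufficiently large `T`" at level `M`; the switch with "`M`
fixed as `T → ∞`"), so every error that is `o(1)` as `T → ∞` for fixed `M` — (3.2)'s `O(M²/L)`, the
switch's `O(M/L)`, the `O(M²R(T))` — is absorbed by the absolute `A√log M` (`M ≥ 4`, `√log M ≥ 1`);
we take `A = 2|A₀| + 4`, `M₀ = 4` and `A' = 0`. Modulo the named fact `glss2026_dsec2`, Theorem 2 is a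
theorem. [cite: GoldstonLeeSchettlerSuriajaya2026, Theorem 2 (proof §4, (4.1)–(4.2))] -/
theorem glss2026_theorem2_of_dsec2 (hd : glss2026_dsec2) : glss2026_theorem2 := by
  obtain ⟨A₀, hA⟩ := id hd
  refine ⟨2 * |A₀| + 4, 4, fun M hM _ R C hRC ↦ ⟨0, ?_⟩⟩
  have hM4 : (4 : ℝ) ≤ M := by exact_mod_cast hM
  have hMpos : (0 : ℝ) < M := by linarith
  have hM1 : 1 ≤ M := by omega
  -- ingredients
  obtain ⟨Csw, Tsw, hCsw, hsw⟩ := exists_switch_le hMpos.le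
  obtain ⟨CP, hCP0, hP⟩ := exists_eventually_card_closePairs_le hd hMpos
  have hnear := eventually_abs_sub_binIndex_le hMpos.le hRC
  have hdT := hA M hMpos
  have hR0 : ∀ T, 0 < R T := hRC.1
  have hRt : Tendsto R atTop (𝓝 0) := hRC.2.2.1
  have hLt : Tendsto L atTop atTop := Real.tendsto_log_atTop.atTop_div_const (by positivity)
  -- the `T`-dependent error terms tend to `0`
  have herr : Tendsto (fun T : ℝ ↦ (|A₀| * (M : ℝ) ^ 2 + Csw * M) * (L T)⁻¹ +
      CP * (|C| * (4 * M + 2) * R T)) atTop (𝓝 0) := by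
    have e1 : Tendsto (fun T : ℝ ↦ (|A₀| * (M : ℝ) ^ 2 + Csw * M) * (L T)⁻¹) atTop (𝓝 0) := by
      simpa using (tendsto_inv_atTop_zero.comp hLt).const_mul (|A₀| * (M : ℝ) ^ 2 + Csw * M)
    have e2 : Tendsto (fun T : ℝ ↦ CP * (|C| * (4 * M + 2) * R T)) atTop (𝓝 0) := by
      simpa [mul_assoc] using hRt.const_mul (CP * (|C| * (4 * M + 2)))
    simpa using e1.add e2
  have hsmall : ∀ᶠ T : ℝ in atTop, (|A₀| * (M : ℝ) ^ 2 + Csw * M) * (L T)⁻¹ +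
      CP * (|C| * (4 * M + 2) * R T) ≤ 1 :=
    herr.eventually (ge_mem_nhds one_pos)  -- eventually ≤ 1
  filter_upwards [eventually_ge_atTop Tsw, hP, hnear, hdT, hsmall, eventually_gt_atTop 1]
    with T hTsw hPT hnT hdT' hsT hT1
  obtain ⟨hr8, hnearT⟩ := hnT
  have hL : 0 < L T := L_pos hT1
  have hT0 : 0 < T := by linarith
  have hTL : 0 < T * L T := mul_pos hT0 hL
  set r : ℝ := |C| * (4 * M + 2) * R T with hr
  have hr0 : 0 ≤ r := by rw [hr]; have := (hR0 T).le; positivity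
  -- the three pair sums
  set S0 : ℝ := ∑ p ∈ closePairs T M, ((M : ℝ) - |AH.pairSpacing T p|) with hS0
  set S1 : ℝ := ∑ p ∈ AH.pairs T M, ((M : ℝ) - |AH.pairSpacing T p|) with hS1
  set Sm : ℝ := ∑ p ∈ AH.pairs T M, model T M p with hSm
  -- (1) `S0 = L·𝒮(T, M)`
  have e0 : S0 = L T * secondMomentSum T M := (L_mul_secondMomentSum hT1 M).symm
  -- (2) the switch: `0 ≤ S0 − S1 ≤ Csw·M·T`
  obtain ⟨hsw0, hsw1⟩ := hsw T hTsw
  -- (3) `|S1 − Sm| ≤ r · CP · TL`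
  have e3 : |S1 - Sm| ≤ r * (CP * (T * L T)) := by
    rw [hS1, hSm, ← Finset.sum_sub_distrib]
    calc |∑ p ∈ AH.pairs T M, (((M : ℝ) - |AH.pairSpacing T p|) - model T M p)|
        ≤ ∑ p ∈ AH.pairs T M, |((M : ℝ) - |AH.pairSpacing T p|) - model T M p| :=
          Finset.abs_sum_le_sum_abs _ _
      _ ≤ ∑ p ∈ AH.pairs T M, r := Finset.sum_le_sum fun p hp ↦
          abs_weight_sub_model_le (hnearT p hp)
      _ = (AH.pairs T (M : ℝ)).card * r := by rw [Finset.sum_const, nsmul_eq_mul]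
      _ ≤ (closePairs T M).card * r := by
          gcongr
          exact pairs_subset_closePairs T M
      _ ≤ CP * (T * L T) * r := by gcongr
      _ = r * (CP * (T * L T)) := by ring
  -- (4) the model sum is the bin sum of (4.1)
  set D : ℤ → ℝ := fun k ↦ AH.binDensity k T M (1 / 2) with hD
  have hcard : ∀ k : ℤ, ((AH.bin k T M (1 / 2)).card : ℝ) = T * L T * D k := by
    intro k
    rw [hD]
    simp only [binDensity_eq_card_div]
    field_simp
  have hsymm : ∀ k : ℤ, (AH.bin (-k) T M (1 / 2)).card = (AH.bin k T M (1 / 2)).card :=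
    card_bin_neg_eq (by linarith) hnearT
  have e4 : Sm = T * L T * ((M : ℝ) * D 0 +
      2 * ∑ j ∈ Finset.Icc 1 M, ((M : ℝ) - j) * (D (2 * (j : ℤ) - 1) + D (2 * (j : ℤ))) +
        ∑ j ∈ Finset.Icc 1 M, D (2 * (j : ℤ) - 1)) := by
    have hj : ∀ j ∈ Finset.Icc 1 M,
        ∑ p ∈ AH.bin (2 * (j : ℤ) - 1) T M (1 / 2), model T M p +
              ∑ p ∈ AH.bin (-(2 * (j : ℤ) - 1)) T M (1 / 2), model T M p +
            (∑ p ∈ AH.bin (2 * (j : ℤ)) T M (1 / 2), model T M p +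
              ∑ p ∈ AH.bin (-(2 * (j : ℤ))) T M (1 / 2), model T M p) =
          T * L T * (2 * (((M : ℝ) - j) * (D (2 * (j : ℤ) - 1) + D (2 * (j : ℤ)))) +
            D (2 * (j : ℤ) - 1)) := by
      intro j hj
      rw [sum_model_bin, sum_model_bin, sum_model_bin, sum_model_bin, hsymm, hsymm,
        hcard, hcard]
      have hj1 : (1 : ℝ) ≤ j := by exact_mod_cast (Finset.mem_Icc.mp hj).1
      have a1 : |(((2 * (j : ℤ) - 1 : ℤ)) : ℝ)| = 2 * (j : ℝ) - 1 := by
        push_cast; exact abs_of_nonneg (by linarith)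
      have a2 : |((-(2 * (j : ℤ) - 1) : ℤ) : ℝ)| = 2 * (j : ℝ) - 1 := by
        push_cast; rw [abs_neg]; exact abs_of_nonneg (by linarith)
      have a3 : |(((2 * (j : ℤ) : ℤ)) : ℝ)| = 2 * (j : ℝ) := by
        push_cast; exact abs_of_nonneg (by linarith)
      have a4 : |((-(2 * (j : ℤ)) : ℤ) : ℝ)| = 2 * (j : ℝ) := by
        push_cast; rw [abs_neg]; exact abs_of_nonneg (by linarith)
      rw [a1, a2, a3, a4]
      ring
    rw [hSm, sum_pairs_eq, sum_model_bin, Finset.sum_congr rfl hj, ← Finset.mul_sum,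
      Finset.sum_add_distrib, ← Finset.mul_sum, hcard 0]
    simp only [Int.cast_zero, abs_zero, zero_div, sub_zero]
    ring
  -- (5) (3.2) at `λ = M`
  have e5 : |secondMomentSum T M / T - (M : ℝ) ^ 2 - Real.log (2 + M) / π ^ 2| ≤
      |A₀| * Real.sqrt (Real.log (2 + M)) + |A₀| * (M : ℝ) ^ 2 * (L T)⁻¹ := by
    have h := hdT'.trans (mul_le_mul_of_nonneg_right (le_abs_self A₀) (by positivity))
    have e : secondMomentSum T M / T - (M : ℝ) ^ 2 - Real.log (2 + M) / π ^ 2 =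
        (secondMomentSum T M - (M : ℝ) ^ 2 * T - T / π ^ 2 * Real.log (2 + M)) / T := by
      field_simp
    rw [e, abs_div, abs_of_pos hT0, div_le_iff₀ hT0]
    have e' : (|A₀| * Real.sqrt (Real.log (2 + M)) + |A₀| * (M : ℝ) ^ 2 * (L T)⁻¹) * T =
        |A₀| * (T * Real.sqrt (Real.log (2 + M)) + (M : ℝ) ^ 2 * T / L T) := by
      field_simp
    rw [e']
    exact h
  -- (6) the arithmetic and the logarithms
  have e6 := abs_mainTerms_sub_le hM1
  have hlogM1 : 1 ≤ Real.log M := by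
    rw [← Real.log_exp 1]
    refine Real.log_le_log (Real.exp_pos 1) ?_
    have := Real.exp_one_lt_d9
    linarith
  have hsq1 : 1 ≤ Real.sqrt (Real.log M) := by
    rw [show (1 : ℝ) = Real.sqrt 1 by simp]
    exact Real.sqrt_le_sqrt hlogM1
  have hlog2M : Real.log (2 + M) ≤ Real.log M + 1 := by
    have h2 : Real.log (2 + (M : ℝ)) ≤ Real.log (2 * M) :=
      Real.log_le_log (by positivity) (by linarith)
    rw [Real.log_mul (by norm_num) hMpos.ne'] at h2
    have := Real.log_two_lt_d9
    linarith
  have hlog2M0 : Real.log M ≤ Real.log (2 + M) := Real.log_le_log hMpos (by linarith)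
  have hsqrt2M : Real.sqrt (Real.log (2 + M)) ≤ Real.sqrt (Real.log M) + 1 :=
    (Real.sqrt_le_sqrt hlog2M).trans (sqrt_add_one_le (by linarith))
  -- (7) assemble
  set Sdd : ℝ := ∑ j ∈ Finset.Icc 1 M, ((M : ℝ) - j) * (D (2 * (j : ℤ) - 1) + D (2 * (j : ℤ)))
    with hSdd
  set Sc : ℝ := ∑ j ∈ Finset.Icc 1 M, ((M : ℝ) - j) * (1 - 2 / (π ^ 2 * (2 * (j : ℝ) - 1) ^ 2))
    with hSc
  set Sodd : ℝ := ∑ j ∈ Finset.Icc 1 M, D (2 * (j : ℤ) - 1) with hSodd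
  have hsplit : ∑ j ∈ Finset.Icc 1 M, ((M : ℝ) - j) *
      (AH.binDensity (2 * (j : ℤ) - 1) T M (1 / 2) + AH.binDensity (2 * (j : ℤ)) T M (1 / 2) -
        (1 - 2 / (π ^ 2 * (2 * (j : ℝ) - 1) ^ 2))) = Sdd - Sc := by
    rw [hSdd, hSc, ← Finset.sum_sub_distrib]
    refine Finset.sum_congr rfl fun j _ ↦ ?_
    simp only [hD]
    ring
  have hB : (M : ℝ) * D 0 + 2 * Sdd + Sodd = Sm / (T * L T) := by
    rw [e4]
    field_simp
  -- the identity behind the estimate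
  have hid : 2 * (Sdd - Sc) - ((3 / 2 - AH.binDensity 0 T M (1 / 2)) * M - Sodd) =
      (secondMomentSum T M / T - (M : ℝ) ^ 2 - Real.log (2 + M) / π ^ 2) +
        ((M : ℝ) ^ 2 + Real.log M / π ^ 2 - (3 / 2 * (M : ℝ) + 2 * Sc)) +
        (Real.log (2 + M) - Real.log M) / π ^ 2 -
        (S0 - S1) / (T * L T) - (S1 - Sm) / (T * L T) := by
    have hD0 : AH.binDensity 0 T M (1 / 2) = D 0 := rfl
    rw [hD0]
    have h1 : 2 * (Sdd - Sc) - ((3 / 2 - D 0) * M - Sodd) =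
        ((M : ℝ) * D 0 + 2 * Sdd + Sodd) - (3 / 2 * (M : ℝ) + 2 * Sc) := by ring
    rw [h1, hB, e0]
    field_simp
    ring
  rw [hsplit, hid]
  -- bounds on the five pieces
  have b1 := abs_le.mp e5
  have b2 : |(M : ℝ) ^ 2 + Real.log M / π ^ 2 - (3 / 2 * (M : ℝ) + 2 * Sc)| ≤ 2 := by
    rw [abs_sub_comm]
    have e : 3 / 2 * (M : ℝ) + 2 * Sc - ((M : ℝ) ^ 2 + Real.log M / π ^ 2) =
        3 / 2 * (M : ℝ) + 2 * Sc - (M : ℝ) ^ 2 - Real.log M / π ^ 2 := by ring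
    rw [e]
    exact e6
  have b2' := abs_le.mp b2
  have b3 : 0 ≤ (Real.log (2 + M) - Real.log M) / π ^ 2 ∧
      (Real.log (2 + M) - Real.log M) / π ^ 2 ≤ 1 := by
    have hπ9 : (9 : ℝ) < π ^ 2 := nine_lt_pi_sq
    have hπ0 : (0 : ℝ) < π ^ 2 := by linarith only [hπ9]
    constructor
    · exact div_nonneg (by linarith only [hlog2M0]) hπ0.le
    · rw [div_le_one hπ0]
      linarith only [hlog2M, hπ9, hlog2M0]
  have b4 : 0 ≤ (S0 - S1) / (T * L T) ∧ (S0 - S1) / (T * L T) ≤ Csw * M * (L T)⁻¹ := by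
    constructor
    · exact div_nonneg hsw0 hTL.le
    · rw [div_le_iff₀ hTL]
      have : Csw * M * (L T)⁻¹ * (T * L T) = Csw * M * T := by field_simp
      rw [this]
      exact hsw1
  have b5 : |(S1 - Sm) / (T * L T)| ≤ CP * r := by
    rw [abs_div, abs_of_pos hTL, div_le_iff₀ hTL]
    calc |S1 - Sm| ≤ r * (CP * (T * L T)) := e3
      _ = CP * r * (T * L T) := by ring
  have b5' := abs_le.mp b5
  -- the small terms are `≤ 1` in total
  have hsmallT : |A₀| * (M : ℝ) ^ 2 * (L T)⁻¹ + Csw * M * (L T)⁻¹ + CP * r ≤ 1 := by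
    have e : |A₀| * (M : ℝ) ^ 2 * (L T)⁻¹ + Csw * M * (L T)⁻¹ + CP * r =
        (|A₀| * (M : ℝ) ^ 2 + Csw * M) * (L T)⁻¹ + CP * (|C| * (4 * M + 2) * R T) := by
      rw [hr]; ring
    rw [e]
    exact hsT
  -- conclusion
  have hfin : |A₀| * Real.sqrt (Real.log (2 + M)) + |A₀| * (M : ℝ) ^ 2 * (L T)⁻¹ + 2 + 1 +
      Csw * M * (L T)⁻¹ + CP * r ≤
      (2 * |A₀| + 4) * Real.sqrt (Real.log M) + 0 * (M : ℝ) ^ 2 * (R T + 1 / L T ^ 2) := by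
    have hA0 : 0 ≤ |A₀| := abs_nonneg _
    have h1 : |A₀| * Real.sqrt (Real.log (2 + M)) ≤ |A₀| * (Real.sqrt (Real.log M) + 1) :=
      mul_le_mul_of_nonneg_left hsqrt2M hA0
    have h2 : (|A₀| + 4) * 1 ≤ (|A₀| + 4) * Real.sqrt (Real.log M) :=
      mul_le_mul_of_nonneg_left hsq1 (by positivity)
    have h3 : 0 * (M : ℝ) ^ 2 * (R T + 1 / L T ^ 2) = 0 := by ring
    linarith only [h1, h2, h3, hsmallT]
  rw [abs_le]
  constructor <;>
    linarith only [b1.1, b1.2, b2'.1, b2'.2, b3.1, b3.2, b4.1, b4.2, b5'.1, b5'.2, hfin]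

/-- **GLSS 2026, Theorem 3 from (3.2) and (AH1)** (Theorem 3 from Theorem 2, Part H of
`AlternativeHypothesisConsequences`). [cite: GoldstonLeeSchettlerSuriajaya2026, Theorem 3] -/
theorem glss2026_theorem3_of_dsec2 (hd : glss2026_dsec2) : glss2026_theorem3 :=
  glss2026_theorem3_of_theorem2 (glss2026_theorem2_of_dsec2 hd)

/-- **GLSS 2026, Theorem 4 from (3.2)** (and AH-Pairs, AH-Weak Density as typed hypotheses).
[cite: GoldstonLeeSchettlerSuriajaya2026, Theorem 4] -/
theorem glss2026_theorem4_of_dsec2 (hd : glss2026_dsec2) : glss2026_theorem4 :=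
  glss2026_theorem4_of_theorem2 (glss2026_theorem2_of_dsec2 hd)

/-- **GLSS 2026, Corollary 2 from (3.2)**. [cite: GoldstonLeeSchettlerSuriajaya2026, Corollary 2] -/
theorem glss2026_corollary2_of_dsec2 (hd : glss2026_dsec2) : glss2026_corollary2 :=
  glss2026_corollary2_of_theorem2 (glss2026_theorem2_of_dsec2 hd)


/-! ### E. The pair-count bound (1.12) ("GMbound") as a theorem from (3.2) (appended 2026-08-26) -/

namespace GLSS2026

open scoped Classical in
/-- The tree's pair-correlation count on the symmetric window `[−h, h]` (pairs `0 < γ, γ' ≤ T` with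
`|γ − γ'| ≤ 2πh/log T`, diagonal included) is the number of pairs with `|x_p| ≤ h`,
`x_p = (γ − γ')L` (`T > 1`). [cite: GoldstonLeeSchettlerSuriajaya2026, §1 eq. (1.12)] -/
theorem pairCorrelationCount_neg_eq_card_closePairs {T : ℝ} (hT : 1 < T) (h : ℝ) :
    pairCorrelationCount (-h) h T = (closePairs T h).card := by
  unfold pairCorrelationCount closePairs
  congr 1
  refine Finset.filter_congr fun p _ ↦ ?_
  have hlog : 0 < Real.log T := Real.log_pos hT
  have hπ2 : (0 : ℝ) < 2 * π := by positivity
  rw [← sub_mul_L, abs_le]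
  unfold L
  have e1 : (zetaOrdinate p.1 - zetaOrdinate p.2) * (Real.log T / (2 * π)) =
      (zetaOrdinate p.1 - zetaOrdinate p.2) * Real.log T / (2 * π) := by ring
  rw [e1, le_div_iff₀ hπ2, div_le_iff₀ hπ2, div_le_iff₀ hlog, le_div_iff₀ hlog]
  constructor
  · rintro ⟨h1, h2⟩
    constructor <;> linarith
  · rintro ⟨h1, h2⟩
    constructor <;> linarith

/-- `√y ≤ y + 1` for `y ≥ 0`. [folklore] -/
private theorem sqrt_le_add_one {y : ℝ} (hy : 0 ≤ y) : Real.sqrt y ≤ y + 1 := by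
  have h1 : y ≤ (y + 1) ^ 2 := by nlinarith
  calc Real.sqrt y ≤ Real.sqrt ((y + 1) ^ 2) := Real.sqrt_le_sqrt h1
    _ = y + 1 := Real.sqrt_sq (by linarith)

/-- **GLSS 2026 (1.12), the unconditional pair-count bound of [GM87], FROM (3.2):** there is an
absolute `C` such that for every `h > 0`, for all large `T`,
`Σ_{0<γ,γ'≤T, |(γ−γ')L| ≤ h} 1 ≤ C(1 + h)·TL` — "`≪ (1 + h)TL`". (From (3.2) at `λ = 2h'`,
`h' = max(h, 1)`: each pair with `|x_p| ≤ h'` contributes `≥ h'/L` to `𝒮(T, 2h') = O((1 + h')h'T)`;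
`C = 10 + 8|A₀|`; the threshold in `T` depends on `h`, as (3.2)'s does on `λ`.)
[cite: GoldstonLeeSchettlerSuriajaya2026, §1 eq. (1.12)] -/
theorem exists_eventually_pairCount_window_le (hd : glss2026_dsec2) :
    ∃ C : ℝ, 0 ≤ C ∧ ∀ h : ℝ, 0 < h → ∀ᶠ T : ℝ in atTop,
      (pairCorrelationCount (-h) h T : ℝ) ≤ C * (1 + h) * (T * L T) := by
  obtain ⟨A₀, hA⟩ := hd
  refine ⟨10 + 8 * |A₀|, by positivity, fun h hh ↦ ?_⟩
  set h' : ℝ := max h 1 with hh'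
  have hh'1 : 1 ≤ h' := le_max_right _ _
  have hhh' : h ≤ h' := le_max_left _ _
  have hh'0 : 0 < h' := by linarith
  have hh'2 : h' ≤ 1 + 2 * h := max_le (by linarith) (by linarith)
  have hLt : Tendsto L atTop atTop := Real.tendsto_log_atTop.atTop_div_const (by positivity)
  filter_upwards [hA (2 * h') (by positivity), eventually_gt_atTop 1, hLt.eventually_ge_atTop 1]
    with T hT hT1 hL1
  have hL : 0 < L T := L_pos hT1
  have hT0 : 0 < T := by linarith
  rw [pairCorrelationCount_neg_eq_card_closePairs hT1]
  -- `h' · #{|x| ≤ h'} ≤ L · 𝒮(T, 2h')`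
  have h1 : h' * ((closePairs T h').card : ℝ) ≤
      ∑ p ∈ closePairs T (2 * h'), (2 * h' - |AH.pairSpacing T p|) := by
    calc h' * ((closePairs T h').card : ℝ) = ∑ p ∈ closePairs T h', h' := by
          rw [Finset.sum_const, nsmul_eq_mul, mul_comm]
      _ ≤ ∑ p ∈ closePairs T h', (2 * h' - |AH.pairSpacing T p|) :=
          Finset.sum_le_sum fun p hp ↦ by linarith [(mem_closePairs.mp hp).2]
      _ ≤ ∑ p ∈ closePairs T (2 * h'), (2 * h' - |AH.pairSpacing T p|) :=
          Finset.sum_le_sum_of_subset_of_nonneg (closePairs_mono T (by linarith))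
            fun p hp _ ↦ by linarith [(mem_closePairs.mp hp).2]
  rw [← L_mul_secondMomentSum hT1 (2 * h')] at h1
  -- `𝒮(T, 2h') ≤ T · K`, `K ≤ (5 + 4|A₀|)(1 + h') h'`
  have hlog0 : 0 ≤ Real.log (2 + 2 * h') := Real.log_nonneg (by linarith)
  have hlog3 : Real.log (2 + 2 * h') ≤ 3 * h' := by
    have := Real.log_le_sub_one_of_pos (by linarith : (0 : ℝ) < 2 + 2 * h')
    linarith
  have hsqrt4 : Real.sqrt (Real.log (2 + 2 * h')) ≤ 4 * h' :=
    (sqrt_le_add_one hlog0).trans (by linarith)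
  have hπ9 : (9 : ℝ) < π ^ 2 := nine_lt_pi_sq
  have hπ0 : (0 : ℝ) < π ^ 2 := by linarith
  have hlogπ : Real.log (2 + 2 * h') / π ^ 2 ≤ h' := by
    rw [div_le_iff₀ hπ0]
    nlinarith
  have h2 : secondMomentSum T (2 * h') ≤
      T * ((2 * h') ^ 2 + h' + |A₀| * (4 * h' + (2 * h') ^ 2)) := by
    have h := (abs_le.mp hT).2
    have hA1 : A₀ * (T * Real.sqrt (Real.log (2 + 2 * h')) + (2 * h') ^ 2 * T / L T) ≤
        |A₀| * (T * Real.sqrt (Real.log (2 + 2 * h')) + (2 * h') ^ 2 * T / L T) :=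
      mul_le_mul_of_nonneg_right (le_abs_self A₀) (by positivity)
    have hfrac : (2 * h') ^ 2 * T / L T ≤ (2 * h') ^ 2 * T := by
      rw [div_le_iff₀ hL]
      have : (2 * h') ^ 2 * T * 1 ≤ (2 * h') ^ 2 * T * L T :=
        mul_le_mul_of_nonneg_left hL1 (by positivity)
      linarith
    have hA2 : |A₀| * (T * Real.sqrt (Real.log (2 + 2 * h')) + (2 * h') ^ 2 * T / L T) ≤
        |A₀| * (T * (4 * h') + (2 * h') ^ 2 * T) := by
      gcongr
    have hmain : T / π ^ 2 * Real.log (2 + 2 * h') ≤ T * h' := by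
      rw [div_mul_eq_mul_div, div_le_iff₀ hπ0]
      have i1 : T * Real.log (2 + 2 * h') ≤ T * (3 * h') := mul_le_mul_of_nonneg_left hlog3 hT0.le
      have i2 : T * h' * 9 ≤ T * h' * π ^ 2 := mul_le_mul_of_nonneg_left hπ9.le (by positivity)
      have i3 : 0 ≤ T * h' := by positivity
      linarith
    have e : T * ((2 * h') ^ 2 + h' + |A₀| * (4 * h' + (2 * h') ^ 2)) =
        (2 * h') ^ 2 * T + T * h' + |A₀| * (T * (4 * h') + (2 * h') ^ 2 * T) := by ring
    rw [e]
    linarith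
  -- combine
  have h3 : h' * ((closePairs T h').card : ℝ) ≤
      L T * (T * ((2 * h') ^ 2 + h' + |A₀| * (4 * h' + (2 * h') ^ 2))) :=
    h1.trans (mul_le_mul_of_nonneg_left h2 hL.le)
  have h4 : ((closePairs T h').card : ℝ) ≤
      (T * L T) * (4 * h' + 1 + |A₀| * (4 + 4 * h')) := by
    refine le_of_mul_le_mul_left ?_ hh'0
    have e : h' * ((T * L T) * (4 * h' + 1 + |A₀| * (4 + 4 * h'))) =
        L T * (T * ((2 * h') ^ 2 + h' + |A₀| * (4 * h' + (2 * h') ^ 2))) := by ring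
    rw [e]
    exact h3
  have h5 : ((closePairs T h).card : ℝ) ≤ (closePairs T h').card := by
    exact_mod_cast Finset.card_le_card (closePairs_mono T hhh')
  have hA0 : 0 ≤ |A₀| := abs_nonneg _
  have hTL : 0 ≤ T * L T := by positivity
  have h6 : 4 * h' + 1 + |A₀| * (4 + 4 * h') ≤ (10 + 8 * |A₀|) * (1 + h) := by nlinarith
  calc ((closePairs T h).card : ℝ) ≤ (closePairs T h').card := h5
    _ ≤ (T * L T) * (4 * h' + 1 + |A₀| * (4 + 4 * h')) := h4
    _ ≤ (T * L T) * ((10 + 8 * |A₀|) * (1 + h)) := mul_le_mul_of_nonneg_left h6 hTL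
    _ = (10 + 8 * |A₀|) * (1 + h) * (T * L T) := by ring

end GLSS2026

end Literature.NumberTheory.LFunctions

end
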